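import Summits.Langlands.Langlands.Theses.HeptagonalTower
import HarnessLib

/-!
# STRATEGY CENSUS r1 (second opinion) — `HeptagonalTower.SectorComplement`
# (ledger item stmt-Langlands-2175, a HOMONYM id; this file concerns ONLY the HeptagonalTower reading
# `SectorComplement := Target → _root_.Langlands`)

crux-strategist REDIRECT unit `cstrat-stmt-Langlands-2175-r1`, 2026-08-17.  Kernel-checked content of
`STRATEGY-CENSUS.md` (r1).  Abbreviations: `C := SectorComplement`, `S := _root_.Langlands`,
`X := Target` (every elliptic curve over every totally real field embedding in some `ℚ(ζ_{7^{m+1}})` is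
modular, Caraiani–Newton rendering inlined).

* §0 SUMMIT STRENGTH (the theorems the tribunal asked for): `S → C`; `C ↔ (X → S)` (`Iff.rfl`);
  `X → (C ↔ S)`; `¬C ↔ X ∧ ¬S`; the CONJUNCT-SPLIT identity `X ∧ C ↔ X ∧ S` (D-0033: the route's open items
  are JOINTLY the summit, `X` is the attacked conjunct — it follows from the four real cruxes, which is the
  content of the route's proved item `Assembly`, stmt-Langlands-16843 — and `C` is the RESIDUAL); and the
  T1(a) shape `(H → C) → H → X → S`: whatever proves `C` proves the summit from the sector theorem.
* §1 STRENGTHEN (new inventory: induction along the FIELD axis, the axis a tower route varies):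
  `LanglandsDegreeInductive` — reciprocity over `F` granted reciprocity over every number field of smaller
  degree — is EQUIVALENT to `S` (`langlands_iff_degreeInductive`, strong induction on `[F:ℚ]`), so the
  inductive hypothesis is free and buys nothing; `S⁺ → C` recorded.
* §2 DECOMPOSITION (new cuts): by RANK `{n = 1, n = 2, n ≥ 3}` and by SIGNATURE `{F totally real,
  F not totally real}` — typed, glue proved (trivial seams: case split on `n` / excluded middle), exactness
  (`S →` each piece) proved; `X` is idle in every piece (it sits inside the known sub-sector of the `n = 2`,
  totally-real piece).  Piece probes `piece → S` are in `bc/Census_r1_probes.lean` (must FAIL; they do).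
* §3 NEGATION (new handle: the summit's fail-safe conjunct): were `ReciprocityData F` EMPTY for one `F`,
  `S` would be false and `C ↔ ¬X` — a kill path for `C` through the route's own success, not a proof.

Nothing here is filed as a line or a split (see STRATEGY-CENSUS.md §Install: the honest placement of `C`
is `residual`, the re-target is `X` = stmt-Langlands-16838).  No statement of the route is asserted:
`C`, `X`, `S` occur only inside `↔`, under `¬`, or as hypotheses.
-/

set_option linter.dupNamespace false

noncomputable section

open scoped NumberField Classical
open Filter IsDedekindDomain
open Literature.NumberTheory.Automorphic Literature.NumberTheory.GaloisRepresentations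
open Summit.Langlands
open Summit.Langlands.Langlands.Theses.HeptagonalTower

namespace Summit.Langlands.Langlands.Cruxes.Assembly.HeptagonalTowerCensusR1

/-! ## §0 Summit strength of `C := SectorComplement` -/

/-- `C` unfolds to `Target → Langlands`. [folklore] -/
theorem sectorComplement_iff_target_imp : SectorComplement ↔ (Target → _root_.Langlands) := Iff.rfl

/-- `S → C`: the item is implied by the summit (discard the sector hypothesis). [folklore] -/
theorem sectorComplement_of_langlands : _root_.Langlands → SectorComplement := fun h _ ↦ h

/-- Under the route target the item IS the summit. [folklore] -/
theorem sectorComplement_iff_langlands_of_target (hX : Target) :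
    SectorComplement ↔ _root_.Langlands :=
  ⟨fun hC ↦ hC hX, fun h _ ↦ h⟩

/-- Exact content of a refutation of the item: prove the sector theorem AND refute the summit.
[folklore] -/
theorem not_sectorComplement_iff : ¬ SectorComplement ↔ Target ∧ ¬ _root_.Langlands :=
  Classical.not_imp

/-- Truth table: `C ↔ ¬X ∨ S`. [folklore] -/
theorem sectorComplement_iff_not_target_or :
    SectorComplement ↔ (¬ Target ∨ _root_.Langlands) :=
  imp_iff_not_or

/-- **The attacked conjunct.** The route's four real cruxes give the sector theorem `Target`
(this is the whole mathematical content of the proved item `Assembly`, stmt-Langlands-16843).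
[folklore] -/
theorem target_of_cruxes (hNV : NonvanishingSevenTwists) (hK : KatoRankZeroSeven)
    (hD : OddDegreeDoor) (hT : TorsionSeven) : Target :=
  fun K _ _ hK' hemb E hE ↦ hD K hK' hemb (hK hNV K hK' hemb) (hT K hK' hemb) E hE

/-- The route's OTHER item literally named `Assembly` (stmt-Langlands-16843, closed `proved`) — pure
logic; re-derived here only to keep this file self-contained. [folklore] -/
theorem assembly_holds : Assembly :=
  fun hNV hK hD hT hC ↦ hC (target_of_cruxes hNV hK hD hT)

/-- Under the four real cruxes the item is literally the summit. [folklore] -/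
theorem sectorComplement_iff_langlands_of_cruxes (hNV : NonvanishingSevenTwists)
    (hK : KatoRankZeroSeven) (hD : OddDegreeDoor) (hT : TorsionSeven) :
    SectorComplement ↔ _root_.Langlands :=
  sectorComplement_iff_langlands_of_target (target_of_cruxes hNV hK hD hT)

/-- **Conjunct-split identity (D-0033).** The route's open items are JOINTLY the summit:
`X ∧ C ↔ X ∧ S`.  `X` (the sector) is the conjunct the route attacks; `C` is the residual. [folklore] -/
theorem target_and_sectorComplement_iff :
    (Target ∧ SectorComplement) ↔ (Target ∧ _root_.Langlands) :=
  ⟨fun h ↦ ⟨h.1, h.2 h.1⟩, fun h ↦ ⟨h.1, fun _ ↦ h.2⟩⟩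

/-- **T1(a) shape.** Any hypothesis `H` that yields `C` yields the summit from the sector theorem:
there is no proof of `C` that is not a proof of `Langlands` from `Target`. [folklore] -/
theorem langlands_of_dominating {H : Prop} (hHC : H → SectorComplement) (h : H) (hX : Target) :
    _root_.Langlands :=
  hHC h hX

/-- The binders of the route's `closes` other than `C` give exactly `X`, and then `C ↔ S`:
the deciding theorem is "sector theorem + residual". [folklore] -/
theorem closes_binders_split (hNV : NonvanishingSevenTwists) (hK : KatoRankZeroSeven)
    (hD : OddDegreeDoor) (hT : TorsionSeven) :
    Target ∧ (SectorComplement ↔ _root_.Langlands) :=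
  ⟨target_of_cruxes hNV hK hD hT, sectorComplement_iff_langlands_of_cruxes hNV hK hD hT⟩

/-! ## §1 STRENGTHEN — induction along the field axis is the summit again -/

/-- Reciprocity at ONE number field `F` (the summit's body). [cite: BuzzardGeeLMS2014, Conj. 3.2.2] -/
def LanglandsAt (F : Type) [Field F] [NumberField F] : Prop :=
  Nonempty (ReciprocityData F) ∧
    ∀ (𝓡 : ReciprocityData F) (n : ℕ), 0 < n →
      ∀ hcpt : isCompact_glFiniteIntegralLevel n F, GlobalLanglandsCorrespondenceGLn n F 𝓡 hcpt

/-- `S` is `∀ F, LanglandsAt F`, definitionally. [folklore] -/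
theorem langlands_iff_forall_langlandsAt :
    _root_.Langlands ↔ ∀ (F : Type) [Field F] [NumberField F], LanglandsAt F :=
  Iff.rfl

/-- `S⁺_deg`: reciprocity over `F` GRANTED reciprocity over every number field of strictly smaller
degree (in particular over `ℚ` and over every proper subfield — the inductive shape a TOWER suggests:
climb `ℚ ⊂ ℚ(ζ₇)⁺ ⊂ ℚ(ζ₄₉)⁺ ⊂ …` one layer at a time). [folklore] -/
def LanglandsDegreeInductive : Prop :=
  ∀ (F : Type) [Field F] [NumberField F],
    (∀ (F₀ : Type) [Field F₀] [NumberField F₀],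
        Module.finrank ℚ F₀ < Module.finrank ℚ F → LanglandsAt F₀) →
      LanglandsAt F

/-- The degree-inductive strengthening is EQUIVALENT to the summit (strong induction on `[F:ℚ]`): the
inductive hypothesis is available for free, hence worthless for the step — base change / descent along
`F/F₀` reaches only the sliver of `ρ`, `π` over `F` that COME from `F₀`. [folklore] -/
theorem langlands_iff_degreeInductive : _root_.Langlands ↔ LanglandsDegreeInductive := by
  constructor
  · intro h F _ _ _
    exact h F
  · intro h
    suffices key : ∀ (d : ℕ) (F : Type) [Field F] [NumberField F],
        Module.finrank ℚ F = d → LanglandsAt F by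
      intro F _ _
      exact key _ F rfl
    intro d
    induction d using Nat.strong_induction_on with
    | _ d ih =>
      intro F _ _ hd
      exact h F (fun F₀ _ _ hlt ↦ ih _ (hd ▸ hlt) F₀ rfl)

/-- … hence `S⁺_deg → C`. [folklore] -/
theorem sectorComplement_of_degreeInductive (h : LanglandsDegreeInductive) : SectorComplement :=
  fun _ ↦ langlands_iff_degreeInductive.2 h

/-! ## §2 DECOMPOSITION — cuts by rank and by signature (typed; glue and exactness proved) -/

/-- Reciprocity in the ranks selected by `P`. [folklore] -/
def LanglandsInRanks (P : ℕ → Prop) : Prop :=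
  ∀ (F : Type) [Field F] [NumberField F],
    Nonempty (ReciprocityData F) ∧
      ∀ (𝓡 : ReciprocityData F) (n : ℕ), 0 < n → P n →
        ∀ hcpt : isCompact_glFiniteIntegralLevel n F, GlobalLanglandsCorrespondenceGLn n F 𝓡 hcpt

/-- D_rk piece 1: `GL₁` — class field theory + algebraic Hecke characters ↔ geometric `ℓ`-adic
characters (Weil, Serre; a THEOREM in print, not in the tree: global CFT). [folklore] -/
def RankOne : Prop := LanglandsInRanks (· = 1)

/-- D_rk piece 2: `GL₂` over every number field (contains even `ρ` / Maass forms over `ℚ`, and `GL₂` over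
non-CM fields; HeptagonalTower's `Target` is a known-technique sub-sector of THIS piece). [folklore] -/
def RankTwo : Prop := LanglandsInRanks (· = 2)

/-- D_rk piece 3: `GL_n`, `n ≥ 3`, over every number field. [folklore] -/
def RankAtLeastThree : Prop := LanglandsInRanks (3 ≤ ·)

/-- Glue of D_rk (trivial seam: case split on `n`). [folklore] -/
theorem langlands_of_ranks (h₁ : RankOne) (h₂ : RankTwo) (h₃ : RankAtLeastThree) :
    _root_.Langlands := by
  intro F _ _
  refine ⟨(h₁ F).1, fun 𝓡 n hn hcpt ↦ ?_⟩
  rcases Nat.lt_or_ge n 3 with h | h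
  · interval_cases n
    · exact (h₁ F).2 𝓡 1 hn rfl hcpt
    · exact (h₂ F).2 𝓡 2 hn rfl hcpt
  · exact (h₃ F).2 𝓡 n hn h hcpt

/-- Exactness of D_rk: each piece is a consequence of `S`. [folklore] -/
theorem ranks_of_langlands (h : _root_.Langlands) : RankOne ∧ RankTwo ∧ RankAtLeastThree :=
  ⟨fun F _ _ ↦ ⟨(h F).1, fun 𝓡 n hn _ hcpt ↦ (h F).2 𝓡 n hn hcpt⟩,
    fun F _ _ ↦ ⟨(h F).1, fun 𝓡 n hn _ hcpt ↦ (h F).2 𝓡 n hn hcpt⟩,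
    fun F _ _ ↦ ⟨(h F).1, fun 𝓡 n hn _ hcpt ↦ (h F).2 𝓡 n hn hcpt⟩⟩

/-- D_rk as a decomposition of `C`: `Target` is bound and DISCARDED — no piece uses the route. [folklore] -/
theorem sectorComplement_of_ranks (h₁ : RankOne) (h₂ : RankTwo) (h₃ : RankAtLeastThree) :
    SectorComplement :=
  fun _ ↦ langlands_of_ranks h₁ h₂ h₃

/-- D_sig piece 1: reciprocity over every TOTALLY REAL field (HeptagonalTower's `Target` lives here,
as the `n = 2`, `V_ℓ E`, 7-tower sub-sector). [folklore] -/
def TotallyRealFields : Prop :=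
  ∀ (F : Type) [Field F] [NumberField F], NumberField.IsTotallyReal F → LanglandsAt F

/-- D_sig piece 2: reciprocity over every field that is NOT totally real.  In substance this piece is the
WHOLE summit: it contains all totally imaginary fields, and reciprocity over the totally imaginary
quadratic extensions `F(√-d)` of a field `F` descends to `F` (cyclic base change and descent,
Arthur–Clozel Ch. 3 Thm 4.2 / 5.1; patching of the Galois representations over an `S`-general family,
Sorensen, as recalled in Chenevier–Harris, Camb. J. Math. 1 (2013) p. 64). [folklore] -/
def NonTotallyRealFields : Prop :=
  ∀ (F : Type) [Field F] [NumberField F], ¬ NumberField.IsTotallyReal F → LanglandsAt F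

/-- Glue of D_sig (trivial seam: excluded middle on the signature). [folklore] -/
theorem langlands_of_signature (h₁ : TotallyRealFields) (h₂ : NonTotallyRealFields) :
    _root_.Langlands :=
  fun F _ _ ↦ (em (NumberField.IsTotallyReal F)).elim (h₁ F) (h₂ F)

/-- Exactness of D_sig. [folklore] -/
theorem signature_of_langlands (h : _root_.Langlands) : TotallyRealFields ∧ NonTotallyRealFields :=
  ⟨fun F _ _ _ ↦ h F, fun F _ _ _ ↦ h F⟩

/-- D_sig as a decomposition of `C`: again `Target` is discarded. [folklore] -/
theorem sectorComplement_of_signature (h₁ : TotallyRealFields) (h₂ : NonTotallyRealFields) :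
    SectorComplement :=
  fun _ ↦ langlands_of_signature h₁ h₂

/-- Where the route's `Target` COULD enter D_sig: only through piece 1, and only on its own plane; the
implication `TotallyRealFields → Target` (true in substance: (B) for `V_ℓ E` plus the half-twist
dictionary) is the converse direction and is not what `C` needs. Recorded as the trivial containment of
hypotheses: a proof of piece 1 may USE `Target` on the plane, nothing more. [folklore] -/
theorem totallyRealFields_of_langlands (h : _root_.Langlands) : TotallyRealFields :=
  (signature_of_langlands h).1

/-! ## §3 NEGATION — the fail-safe conjunct as the only cheap door, and what it would do to `C` -/

/-- Were the reciprocity-data interface EMPTY at one number field, the summit would be FALSE …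
[folklore] -/
theorem not_langlands_of_isEmpty_reciprocityData (F : Type) [Field F] [NumberField F]
    (h : IsEmpty (ReciprocityData F)) : ¬ _root_.Langlands :=
  fun hL ↦ (hL F).1.elim fun 𝓡 ↦ h.false 𝓡

/-- … and then `C ↔ ¬ Target`: the item would be REFUTED by the route's own success (a proof of the
sector theorem), never proved.  The door is expected shut (`Nonempty (ReciprocityData F)` from
Harris–Taylor Thm A / Henniart with the canonical Artin pins — item stmt-Langlands-17930 of
PrimeSwitchSplit, birth registered), so this is a recorded kill path, not a line. [folklore] -/
theorem sectorComplement_iff_not_target_of_isEmpty_reciprocityData (F : Type) [Field F]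
    [NumberField F] (h : IsEmpty (ReciprocityData F)) : SectorComplement ↔ ¬ Target :=
  ⟨fun hC hX ↦ not_langlands_of_isEmpty_reciprocityData F h (hC hX),
    fun hnX hX ↦ (hnX hX).elim⟩

/-- Conversely, while `Target` is open NO refutation of `C` exists short of `¬ Langlands`:
`¬ C → ¬ S`. [folklore] -/
theorem not_langlands_of_not_sectorComplement (h : ¬ SectorComplement) : ¬ _root_.Langlands :=
  fun hL ↦ h (sectorComplement_of_langlands hL)

end Summit.Langlands.Langlands.Cruxes.Assembly.HeptagonalTowerCensusR1

end
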